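import Summits.CriticalPhenomena.PercolationContinuityZ3.Theorems.PercNearOneGluingNoHeavyRsw3SlabWalls
import Summits.CriticalPhenomena.PercolationContinuityZ3.Theorems.PercNearOneGluingNoHeavyRsw3AnnulusBKCovering
import HarnessLib

/-!
# RSW3 lane (P2, gen 9): MANY SPANNING CLUSTERS IN THIN SLAB-BOXES OF `ℤ³` — `X_B ⇒ P_{p_c}(N^sp ≥ m) ≥ c^m` for
# `{0..n} × {0..M}²`, `M ≥ 30 n m`, uniformly in `n` (Aizenman's `K_L(m) > 0` for `d = 3`, conditional on `X_B`);
# unconditional MANY-CLUSTERS-OR-ANNULUS-CROSSING dichotomy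

builds on p205010 (kernel theorem, internal audit signed; external expert review pending)

Cell `prim-rsw3`, prover seat `prim-rsw3-p2` (gen 9), memo `run/shared/lean/prim/rsw3/P2-RSWLITE.md` §15.
Support file (`--supports stmt-CriticalPhenomena-4575`); no definitions, no named facts, no sorries.

Notation: `N^sp = Crossing.blockSpanningCount ![n, M, M] 0` (number of open clusters of the slab-box `{0..n} × {0..M}²`, free b.c.,
meeting both faces `{x₀ = 0}`, `{x₀ = n}`; Aizenman's `N_Free`, census Q3); `σ₂(n) = P_p(boxCross (easyShape 2 n) 0)`
(`≥ c_E` at `p_c`, `Rsw3.easyCrossingLowerBound_two`); `u_p(r, 2r) = P_p(SurfaceTension.boxCrossing 3 r (2r))`; `r = max 1 ⌊(n-1)/2⌋`.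

* `pow_le_real_le_blockSpanningCount` — EVERY `p`, `n ≥ 1`, `m`, `M ≥ 30 n m`:
  `(σ₂(n) · (1 - u_p(r, 2r))^{192})^m ≤ P_p(m ≤ N^sp)`.  Construction: `m` translates `R_i = {0..n} × [a_i, a_i+2n] × [0,2n]`
  (`a_i = 2g + (2n+9g) i`, `g = 2r+1`) of the easy block, each crossed in the thin direction with probability `≥ σ₂(n)`
  (`real_linked_image`, `Rsw3.real_boxCross_le_real_linked_faces`), each surrounded by three walls of blocked annuli
  (`Rsw3.sealed_of_walls`): the cluster of `R_i`'s crossing stays in `{a_i - 2g < x₁ < a_i + 2n + 7g}`, the footprints are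
  pairwise disjoint, so the `m` events `Y_i = C_i ∩ W_i` are independent, each of probability `P(C_i)P(W_i) ≥ σ₂(n)(1-u)^{192}`
  (independence on disjoint edge sets; Harris for the `192` decreasing wall events, `Rsw3.prod_le_real_biInter_of_isLowerSet`;
  translation invariance `Rsw3.real_sCrossAt_eq`), and on `⋂ Y_i` the slab has `≥ m` spanning clusters
  (`Rsw3.prod_le_real_card_le_blockSpanningCount`).
* `exists_pow_le_real_le_blockSpanningCount_criticalProbI` — at `p_c(ℤ³)`, UNCONDITIONAL: `∃ c > 0` with
  `(c (1 - u_{p_c}(r,2r))^{192})^m ≤ P_{p_c}(m ≤ N^sp)` for all `n ≥ 1`, `m`, `M ≥ 30 n m` — many spanning clusters OR a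
  near-certain aspect-2 annulus crossing at scale `≈ n/2`, at every scale.
* `exists_pow_le_real_le_blockSpanningCount_of_critAnnulusNonCrossing` — **`X_B ⇒ ∃ c > 0, ∀ n ≥ 1, ∀ m, ∀ M ≥ 30 n m,
  c^m ≤ P_{p_c}(m ≤ N^sp(n, M))`**: under the 3-D RSW upper bound `X_B` (stmt-CriticalPhenomena-0846), thin slab-boxes of `ℤ³`
  carry ANY prescribed number of incipient spanning clusters with probability bounded below uniformly in the thickness —
  Aizenman's planar statement `K_L(m) ≥ h₂(2m-1)^{2m-1}` (1997, §3 (3.0)) transplanted to `d = 3` conditionally on `X_B`.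

HONEST PLACEMENT.  Unconditionally the tree has `m = 2` (`Rsw3.aizenman_twoSpanningClusters_criticalProbI`, Aizenman 1997
Thm. 2, `M ≥ K n` with `K ≈ 10⁷–10¹⁵`).  Here: every `m`, `M ≥ 30 n m`, but CONDITIONAL on `X_B` (open; false above six
dimensions) — or, unconditionally, as a dichotomy against near-certain annulus crossings.  The constant `30` and the exponent
`192` are artefacts of the grid bookkeeping.  Numerically (lane census, non-rigorous) `E N^sp ≈ 3.94` for the `1:3:3` block and
`u(n,2n) ≈ 0.998` at `p_c(ℤ³)`.

References: M. Aizenman, Nucl. Phys. B 485 (1997) 551–582, §2 Thm. 2 and Remark 2, §3 (3.0), §5 [Aizenman1997]; C. Borgs,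
J. Chayes, H. Kesten, J. Spencer, Random Structures Algorithms 15 (1999) 368–413, §1 [BorgsChayesKestenSpencer1999];
G. Grimmett, *Percolation* (1999), §1.3, §2.2 Thm. (2.4) [GrimmettPercolation1999]. [folklore]
-/

noncomputable section

namespace Summit.CriticalPhenomena.PercolationContinuityZ3.Theorems

open MeasureTheory ProbabilityTheory Filter Topology
open Literature.Probability.Percolation Literature.Probability.LatticeModels
open Literature.Barriers.CriticalPhenomena

namespace Rsw3

open SurfaceTension Crossing

/-- **SEALED REGIONS IN A SLAB, every `p`.**  For `n ≥ 1`, `r = max 1 ⌊(n-1)/2⌋`, every `m` and every `M ≥ 30 n m`: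
`(σ₂(n) · (1 - u_p(r, 2r))^{192})^m ≤ P_p(m ≤ blockSpanningCount ![n, M, M] 0)` — `m` independent sealed regions (module
docstring). [folklore] -/
theorem pow_le_real_le_blockSpanningCount (p : unitInterval) {n : ℕ} (hn : 1 ≤ n) (m : ℕ) {M : ℕ}
    (hM : 30 * n * m ≤ M) :
    ((bondPercolation (zdGraph 3) p).real (boxCross (easyShape 2 n) 0) *
        (1 - (bondPercolation (zdGraph 3) p).real
          (boxCrossing 3 (max 1 ((n - 1) / 2)) (2 * max 1 ((n - 1) / 2)))) ^ 192) ^ m ≤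
      (bondPercolation (zdGraph 3) p).real
        {ω | (m : ℕ∞) ≤ blockSpanningCount ![(n : ℤ), M, M] 0 ω} := by
  classical
  set μ := bondPercolation (zdGraph 3) p with hμ
  set r : ℕ := max 1 ((n - 1) / 2) with hr
  have hr1 : 1 ≤ r := le_max_left _ _
  have hrn : n ≤ 2 * r + 2 := by
    rcases le_or_gt n 2 with h | h
    · omega
    · have : (n - 1) / 2 ≤ r := le_max_right _ _
      omega
  have hrn' : r ≤ n := by
    rcases le_or_gt n 2 with h | h
    · have : r = 1 := by rw [hr]; apply le_antisymm (max_le le_rfl (by omega)) (le_max_left _ _)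
      omega
    · have : r = (n - 1) / 2 := by rw [hr]; exact max_eq_right (by omega)
      omega
  obtain ⟨g, hg⟩ : ∃ g : ℤ, g = 2 * (r : ℤ) + 1 := ⟨_, rfl⟩
  have hr1z : (1 : ℤ) ≤ r := by exact_mod_cast hr1
  have hrnz : (n : ℤ) ≤ 2 * r + 2 := by exact_mod_cast hrn
  have hrnz' : (r : ℤ) ≤ n := by exact_mod_cast hrn'
  have hg3 : (3 : ℤ) ≤ g := by rw [hg]; omega
  have hgn : (n : ℤ) ≤ g + 1 := by rw [hg]; omega
  have hgn' : g ≤ 2 * (n : ℤ) + 1 := by rw [hg]; omega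
  have hn0 : (0 : ℤ) ≤ n := by positivity
  -- positions of the regions
  obtain ⟨a, ha⟩ : ∃ a : ℕ → ℤ, ∀ i, a i = 2 * g + (2 * (n : ℤ) + 9 * g) * i := ⟨_, fun _ => rfl⟩
  have ha_nonneg : ∀ i, 0 ≤ a i := fun i => by rw [ha]; positivity
  have ha_sep : ∀ i j : ℕ, i < j → a i + (2 * (n : ℤ) + 9 * g) ≤ a j := by
    intro i j hij
    rw [ha, ha]
    have : (i : ℤ) + 1 ≤ j := by exact_mod_cast hij
    have h0 : 0 ≤ 2 * (n : ℤ) + 9 * g := by positivity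
    nlinarith
  have ha_le : ∀ i, i < m → a i + 2 * n ≤ (M : ℤ) := by
    intro i hi
    have him : (i : ℤ) + 1 ≤ m := by exact_mod_cast hi
    have hM' : (30 * n * m : ℤ) ≤ M := by exact_mod_cast hM
    have hcoef : 2 * (n : ℤ) + 9 * g ≤ 29 * n := by
      have : (1 : ℤ) ≤ n := by exact_mod_cast hn
      linarith
    have h0 : 0 ≤ 2 * (n : ℤ) + 9 * g := by positivity
    rw [ha]
    nlinarith
  have hM2 : m ≠ 0 → 2 * (n : ℤ) ≤ M := by
    intro hm
    have h1 : 2 * n ≤ 30 * n * m :=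
      calc 2 * n ≤ 30 * n * 1 := by omega
        _ ≤ 30 * n * m := Nat.mul_le_mul_left _ (by omega)
    exact_mod_cast h1.trans hM
  -- the block, faces, translations
  set blk : Finset (Site 3) := Finset.Icc (0 : Site 3) (easyShape 2 n) with hblk
  set F0 : Set (Site 3) := {x | x ∈ blk ∧ x 0 = 0} with hF0
  set F1 : Set (Site 3) := {x | x ∈ blk ∧ x 0 = easyShape 2 n 0} with hF1
  have hE0 : easyShape 2 n 0 = n := by simp [easyShape]
  have hE : ∀ j : Fin 3, j ≠ 0 → easyShape 2 n j = 2 * n := by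
    intro j hj; fin_cases j <;> simp [easyShape] at hj ⊢
  have hmem_blk : ∀ x : Site 3, x ∈ blk → (0 ≤ x 0 ∧ x 0 ≤ n) ∧ (0 ≤ x 1 ∧ x 1 ≤ 2 * n) ∧ (0 ≤ x 2 ∧ x 2 ≤ 2 * n) := by
    intro x hx
    have h := mem_Icc_zero_iff_forall.1 hx
    refine ⟨⟨(h 0).1, by simpa [hE0] using (h 0).2⟩, ⟨(h 1).1, ?_⟩, ⟨(h 2).1, ?_⟩⟩
    · have := (h 1).2; rwa [hE 1 (by decide)] at this
    · have := (h 2).2; rwa [hE 2 (by decide)] at this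
  obtain ⟨v, hv0, hv1, hv2⟩ : ∃ v : ℕ → Site 3, (∀ i, v i 0 = 0) ∧ (∀ i, v i 1 = a i) ∧ (∀ i, v i 2 = 0) :=
    ⟨fun i => ![0, a i, 0], fun i => by simp, fun i => by simp, fun i => by simp⟩
  set C : ℕ → Set (BondConfig (Site 3)) := fun i =>
    linked ((zdShiftIso (v i)) '' (↑blk : Set (Site 3))) ((zdShiftIso (v i)) '' F0) ((zdShiftIso (v i)) '' F1) with hC
  -- wall centres
  set Q : Finset (Fin 3 × (ℤ × ℤ)) := Finset.univ ×ˢ (Finset.Icc (0 : ℤ) 7 ×ˢ Finset.Icc (0 : ℤ) 7) with hQ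
  have hQcard : Q.card = 192 := by rw [hQ, Finset.card_product, Finset.card_product]; simp
  have hQmem : ∀ q ∈ Q, (0 ≤ q.2.1 ∧ q.2.1 ≤ 7) ∧ (0 ≤ q.2.2 ∧ q.2.2 ≤ 7) := by
    intro q hq
    simp only [hQ, Finset.mem_product, Finset.mem_univ, Finset.mem_Icc, true_and] at hq
    exact hq
  obtain ⟨zc, hzc0, hzc1, hzc2⟩ : ∃ zc : ℕ → Fin 3 × (ℤ × ℤ) → Site 3,
      (∀ i q, zc i q 0 = g * q.2.1) ∧
      (∀ i q, zc i q 1 =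
        if q.1 = 2 then a i - g + g * q.2.2 else if q.1 = 0 then a i - g else a i + 2 * n + g) ∧
      (∀ i q, zc i q 2 = if q.1 = 2 then 2 * n + g else g * q.2.2) :=
    ⟨fun i q => ![g * q.2.1,
        if q.1 = 2 then a i - g + g * q.2.2 else if q.1 = 0 then a i - g else a i + 2 * n + g,
        if q.1 = 2 then 2 * n + g else g * q.2.2],
      fun i q => by simp, fun i q => by simp, fun i q => by simp⟩
  -- footprint of the wall balls: `a i - 2g < x₁ < a i + 2n + 7g`, away from `R_i`
  have hfpW : ∀ i, ∀ q ∈ Q, ∀ y ∈ (box 3 (2 * r)).image (· + zc i q),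
      (a i - 2 * g < y 1 ∧ y 1 < a i + 2 * n + 7 * g) ∧
        (y 1 < a i ∨ a i + 2 * n < y 1 ∨ 2 * (n : ℤ) < y 2) := by
    intro i q hq y hy
    rw [Finset.mem_image] at hy
    obtain ⟨w, hw, rfl⟩ := hy
    have hw1 := (mem_box.1 hw) 1; have hw2 := (mem_box.1 hw) 2
    obtain ⟨⟨hj1, hj1'⟩, hj2, hj2'⟩ := hQmem q hq
    simp only [Pi.add_apply]
    rw [hzc1, hzc2]
    push_cast at hw1 hw2
    split_ifs with h2 h0
    · exact ⟨⟨by nlinarith, by nlinarith⟩, Or.inr (Or.inr (by linarith))⟩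
    · exact ⟨⟨by linarith, by linarith⟩, Or.inl (by linarith)⟩
    · exact ⟨⟨by linarith, by linarith⟩, Or.inr (Or.inl (by linarith))⟩
  have hfpC : ∀ i, ∀ y ∈ blk.image (· + v i), a i ≤ y 1 ∧ y 1 ≤ a i + 2 * n ∧ 0 ≤ y 2 ∧ y 2 ≤ 2 * n := by
    intro i y hy
    rw [Finset.mem_image] at hy
    obtain ⟨w, hw, rfl⟩ := hy
    obtain ⟨-, ⟨h1, h1'⟩, h2, h2'⟩ := hmem_blk w hw
    simp only [Pi.add_apply, hv1, hv2]
    omega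
  -- events
  set A : Site 3 → Set (BondConfig (Site 3)) := fun z =>
    (linked (↑((box 3 (2 * r)).image (· + z)) : Set (Site 3))
      ((zdShiftIso z) '' ↑(innerBoundary (zdGraph 3) (box 3 (2 * r)))) (sbox z r))ᶜ with hA
  have hsb : ∀ z, (↑((box 3 (2 * r)).image (· + z)) : Set (Site 3)) = sbox z (2 * r) := by
    intro z; rw [sbox, zdShiftIso_image_box]
  set W : ℕ → Set (BondConfig (Site 3)) := fun i => ⋂ q ∈ Q, A (zc i q) with hW
  set Y : ℕ → Set (BondConfig (Site 3)) := fun i => C i ∩ W i with hY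
  set TC : ℕ → Set (Sym2 (Site 3)) := fun i => ↑(edgesIn (zdGraph 3) (blk.image (· + v i))) with hTC
  set TW : ℕ → Set (Sym2 (Site 3)) := fun i =>
    ⋃ q ∈ Q, (↑(edgesIn (zdGraph 3) ((box 3 (2 * r)).image (· + zc i q))) : Set (Sym2 (Site 3))) with hTW
  set T : ℕ → Set (Sym2 (Site 3)) := fun i => TC i ∪ TW i with hT
  have hPC : ∀ i, μ.real (boxCross (easyShape 2 n) 0) ≤ μ.real (C i) := by
    intro i
    have himg := real_linked_image (zdShiftIso (v i)) p (↑blk : Set (Site 3)) F0 F1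
    rw [← hμ] at himg
    have : μ.real (C i) = μ.real (linked (↑blk : Set (Site 3)) F0 F1) := by rw [hC]; exact himg
    rw [this, hF0, hF1, hblk]
    exact real_boxCross_le_real_linked_faces p (easyShape 2 n) 0
  have himg : ∀ i, (zdShiftIso (v i)) '' (↑blk : Set (Site 3)) = ↑(blk.image (· + v i)) := by
    intro i; rw [Finset.coe_image]; rfl
  have hdetC : ∀ i, DeterminedBy (C i) (TC i) := by
    intro i
    show DeterminedBy (linked ((zdShiftIso (v i)) '' (↑blk : Set (Site 3))) ((zdShiftIso (v i)) '' F0)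
      ((zdShiftIso (v i)) '' F1)) _
    rw [himg i]
    exact determinedBy_linked_edgesIn _ _ _
  have hdetA : ∀ i, ∀ q ∈ Q, DeterminedBy (A (zc i q))
      (↑(edgesIn (zdGraph 3) ((box 3 (2 * r)).image (· + zc i q))) : Set (Sym2 (Site 3))) :=
    fun i q _ => (determinedBy_linked_edgesIn _ _ _).compl'
  have hdetW : ∀ i, DeterminedBy (W i) (TW i) := fun i => DeterminedBy.biInter Q (hdetA i)
  have hdetY : ∀ i, DeterminedBy (Y i) (T i) := fun i =>
    ((hdetC i).mono Set.subset_union_left).inter ((hdetW i).mono Set.subset_union_right)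
  have hCm : ∀ i, MeasurableSet (C i) := fun i => measurableSet_linked _ _ _
  have hAm : ∀ i, ∀ q ∈ Q, MeasurableSet (A (zc i q)) := fun i q _ => (measurableSet_linked _ _ _).compl
  have hWm : ∀ i, MeasurableSet (W i) := fun i => MeasurableSet.biInter Q.countable_toSet (hAm i)
  have hYm : ∀ i, MeasurableSet (Y i) := fun i => (hCm i).inter (hWm i)
  have hT_fp : ∀ i, ∀ e ∈ T i, ∀ y ∈ e, a i - 2 * g < y 1 ∧ y 1 < a i + 2 * n + 7 * g := by
    intro i e he y hy
    rcases he with he | he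
    · rw [Finset.mem_coe, mem_edgesIn_iff] at he
      obtain ⟨h1, h2, -⟩ := hfpC i y (he.2 y hy)
      constructor <;> linarith
    · rw [Set.mem_iUnion₂] at he
      obtain ⟨q, hq, he⟩ := he
      rw [Finset.mem_coe, mem_edgesIn_iff] at he
      exact (hfpW i q hq y (he.2 y hy)).1
  have hdisj : (↑(Finset.range m) : Set ℕ).PairwiseDisjoint T := by
    intro i _ j _ hij
    rw [Function.onFun, Set.disjoint_left]
    intro e hei hej
    obtain ⟨hi1, hi2⟩ := hT_fp i e hei _ (Sym2.out_fst_mem e)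
    obtain ⟨hj1, hj2⟩ := hT_fp j e hej _ (Sym2.out_fst_mem e)
    rcases lt_or_gt_of_ne hij with h | h
    · have := ha_sep i j h; linarith
    · have := ha_sep j i h; linarith
  have hdisjCW : ∀ i, Disjoint (TC i) (TW i) := by
    intro i
    rw [Set.disjoint_left]
    intro e heC heW
    have heC' : e ∈ edgesIn (zdGraph 3) (blk.image (· + v i)) := Finset.mem_coe.1 heC
    rw [mem_edgesIn_iff] at heC'
    have heW' : e ∈ TW i := heW
    rw [hTW, Set.mem_iUnion₂] at heW'
    obtain ⟨q, hq, heW'⟩ := heW'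
    rw [Finset.mem_coe, mem_edgesIn_iff] at heW'
    obtain ⟨h1, h2, -, h4⟩ := hfpC i _ (heC'.2 _ (Sym2.out_fst_mem e))
    obtain ⟨-, h⟩ := hfpW i q hq _ (heW'.2 _ (Sym2.out_fst_mem e))
    rcases h with h | h | h <;> linarith
  have hPA : ∀ i, ∀ q ∈ Q, μ.real (A (zc i q)) = 1 - μ.real (boxCrossing 3 r (2 * r)) := by
    intro i q _
    show μ.real (linked (↑((box 3 (2 * r)).image (· + zc i q)) : Set (Site 3))
      ((zdShiftIso (zc i q)) '' ↑(innerBoundary (zdGraph 3) (box 3 (2 * r)))) (sbox (zc i q) r))ᶜ = _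
    rw [probReal_compl_eq_one_sub (measurableSet_linked _ _ _), hsb, hμ, real_sCrossAt_eq]
  have hPW : ∀ i, (1 - μ.real (boxCrossing 3 r (2 * r))) ^ 192 ≤ μ.real (W i) := by
    intro i
    have hlow : ∀ q ∈ Q, IsLowerSet (A (zc i q)) := fun q _ => (isUpperSet_linked _ _ _).compl
    have h := prod_le_real_biInter_of_isLowerSet (zdGraph 3) p Q (fun q => A (zc i q)) hlow (hAm i)
    rw [Finset.prod_congr rfl (hPA i), Finset.prod_const, hQcard] at h
    exact h
  have hβ0 : 0 ≤ 1 - μ.real (boxCrossing 3 r (2 * r)) := by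
    have := measureReal_le_one (μ := μ) (s := boxCrossing 3 r (2 * r)); linarith
  have hPY : ∀ i, μ.real (boxCross (easyShape 2 n) 0) * (1 - μ.real (boxCrossing 3 r (2 * r))) ^ 192 ≤
      μ.real (Y i) := by
    intro i
    have hind : μ.real (Y i) = μ.real (C i) * μ.real (W i) :=
      bondPercolation_real_inter_of_disjoint (zdGraph 3) p (hdisjCW i) (hdetC i) (hdetW i) (hCm i) (hWm i)
    rw [hind]
    exact mul_le_mul (hPC i) (hPW i) (pow_nonneg hβ0 _) measureReal_nonneg
  -- (6) regions lie inside the slab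
  set L : Site 3 := ![(n : ℤ), M, M] with hL
  have hL0 : L 0 = n := by simp [hL]
  have hL1 : L 1 = M := by simp [hL]
  have hL2 : L 2 = M := by simp [hL]
  have hsubS : ∀ i, i < m → (zdShiftIso (v i)) '' (↑blk : Set (Site 3)) ⊆ ↑(Finset.Icc (0 : Site 3) L) := by
    intro i hi
    rw [himg i]
    intro y hy
    have hy' : y ∈ blk.image (· + v i) := Finset.mem_coe.1 hy
    have hfp := hfpC i y hy'
    rw [Finset.mem_image] at hy'
    obtain ⟨w, hw, rfl⟩ := hy'
    obtain ⟨⟨hw00, hw01⟩, -⟩ := hmem_blk w hw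
    have haM := ha_le i hi
    have ha0 := ha_nonneg i
    have hM2' := hM2 (by omega)
    rw [Finset.mem_coe, mem_Icc_zero_iff_forall, forall_fin_three, hL0, hL1, hL2]
    have h0 : (w + v i) 0 = w 0 := by rw [Pi.add_apply, hv0, add_zero]
    rw [h0]
    exact ⟨⟨hw00, hw01⟩, ⟨ha0.trans hfp.1, hfp.2.1.trans haM⟩, ⟨hfp.2.2.1, hfp.2.2.2.trans hM2'⟩⟩
  set P : ℕ → Set (Site 3) := fun i => (zdShiftIso (v i)) '' F0 with hP
  have hPsub : ∀ i ∈ Finset.range m, P i ⊆ {x | x ∈ Finset.Icc (0 : Site 3) L ∧ x 0 = 0} := by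
    intro i hi
    rw [Finset.mem_range] at hi
    rintro _ ⟨w, ⟨hw, hw0⟩, rfl⟩
    refine ⟨Finset.mem_coe.1 (hsubS i hi ⟨w, Finset.mem_coe.2 hw, rfl⟩), ?_⟩
    rw [zdShiftIso_apply, Pi.add_apply, hw0, hv0]; simp
  -- (8) spanning on `Y i`
  have hspan : ∀ ω, ω ⊆ (zdGraph 3).edgeSet → ∀ i ∈ Finset.range m, ω ∈ Y i →
      ∃ x ∈ P i, ∃ y ∈ Finset.Icc (0 : Site 3) L, y 0 = L 0 ∧
        ω ∈ inConn (↑(Finset.Icc (0 : Site 3) L) : Set (Site 3)) x y := by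
    intro ω _ i hi hYi
    rw [Finset.mem_range] at hi
    have hCi : ω ∈ linked ((zdShiftIso (v i)) '' (↑blk : Set (Site 3))) ((zdShiftIso (v i)) '' F0)
        ((zdShiftIso (v i)) '' F1) := hYi.1
    rw [mem_linked_iff] at hCi
    obtain ⟨x, hx, _, ⟨w, ⟨hw, hw0⟩, rfl⟩, hxb⟩ := hCi
    refine ⟨x, hx, (zdShiftIso (v i)) w, Finset.mem_coe.1 (hsubS i hi ⟨w, Finset.mem_coe.2 hw, rfl⟩), ?_,
      inConn_mono (hsubS i hi) _ _ hxb⟩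
    rw [zdShiftIso_apply, Pi.add_apply, hw0, hE0, hv0, hL0]; simp
  -- (9) separation, by sealing
  have hsep : ∀ ω, ω ⊆ (zdGraph 3).edgeSet → ∀ i ∈ Finset.range m, ∀ j ∈ Finset.range m, i ≠ j →
      ω ∈ Y i → ω ∈ Y j → ∀ x ∈ P i, ∀ x' ∈ P j,
        ω ∉ inConn (↑(Finset.Icc (0 : Site 3) L) : Set (Site 3)) x x' := by
    intro ω _ i _ j _ hij hYi hYj x hx x' hx' hconn
    rw [mem_inConn_iff] at hconn
    have hxR : x ∈ blk.image (· + v i) := by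
      obtain ⟨w, ⟨hw, -⟩, rfl⟩ := hx
      exact Finset.mem_image.2 ⟨w, hw, rfl⟩
    have hx'R : x' ∈ blk.image (· + v j) := by
      obtain ⟨w, ⟨hw, -⟩, rfl⟩ := hx'
      exact Finset.mem_image.2 ⟨w, hw, rfl⟩
    have hWi : ∀ q ∈ Q, ω ∉ linked (sbox (zc i q) (2 * r))
        ((zdShiftIso (zc i q)) '' ↑(innerBoundary (zdGraph 3) (box 3 (2 * r)))) (sbox (zc i q) r) := by
      intro q hq hmem
      have h := (Set.mem_iInter₂.1 hYi.2) q hq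
      rw [← hsb (zc i q)] at hmem
      exact h hmem
    rw [hL] at hconn
    obtain ⟨hlo, hhi, -⟩ := sealed_of_walls (M := M) hg hr1 hgn (zc i) (hzc0 i) (hzc1 i) (hzc2 i) hWi
      (hfpC i x hxR) hconn
    obtain ⟨h1, h2, -⟩ := hfpC j x' hx'R
    rcases lt_or_gt_of_ne hij with h | h
    · have := ha_sep i j h; linarith
    · have := ha_sep j i h; linarith
  have hmain := prod_le_real_card_le_blockSpanningCount p (Finset.range m) L Y T (fun i _ => hdetY i)
    (fun i _ => hYm i) hdisj P hPsub hspan hsep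
  rw [Finset.card_range] at hmain
  have h0 : 0 ≤ μ.real (boxCross (easyShape 2 n) 0) * (1 - μ.real (boxCrossing 3 r (2 * r))) ^ 192 :=
    mul_nonneg measureReal_nonneg (pow_nonneg hβ0 _)
  calc (μ.real (boxCross (easyShape 2 n) 0) * (1 - μ.real (boxCrossing 3 r (2 * r))) ^ 192) ^ m
      = ∏ _i ∈ Finset.range m,
          μ.real (boxCross (easyShape 2 n) 0) * (1 - μ.real (boxCrossing 3 r (2 * r))) ^ 192 := by
        rw [Finset.prod_const, Finset.card_range]
    _ ≤ ∏ i ∈ Finset.range m, μ.real (Y i) := Finset.prod_le_prod (fun _ _ => h0) fun i _ => hPY i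
    _ ≤ _ := hmain

/-! ## At `p_c(ℤ³)`: the unconditional dichotomy, and proliferation under `X_B` -/

/-- **MANY-CLUSTERS-OR-ANNULUS-CROSSING at `p_c(ℤ³)`, unconditional.**  There is `c > 0` (the `EasyCrossingLowerBound 2`
constant) such that for all `n ≥ 1`, `m`, `M ≥ 30 n m`, with `r = max 1 ⌊(n-1)/2⌋`:
`(c · (1 - u_{p_c}(r, 2r))^{192})^m ≤ P_{p_c}(m ≤ blockSpanningCount ![n, M, M] 0)`.  At every scale, EITHER thin slab-boxes
carry arbitrarily many spanning clusters with geometric-in-`m` probability, OR the aspect-2 annulus at scale `≈ n/2` is crossed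
with probability close to one.  builds on p205010 (kernel theorem, internal audit signed; external expert review pending). [folklore] -/
theorem exists_pow_le_real_le_blockSpanningCount_criticalProbI :
    ∃ c : ℝ, 0 < c ∧ ∀ n : ℕ, 1 ≤ n → ∀ m M : ℕ, 30 * n * m ≤ M →
      (c * (1 - (bondPercolation (zdGraph 3) (criticalProbI 3)).real
          (boxCrossing 3 (max 1 ((n - 1) / 2)) (2 * max 1 ((n - 1) / 2)))) ^ 192) ^ m ≤
        (bondPercolation (zdGraph 3) (criticalProbI 3)).real
          {ω | (m : ℕ∞) ≤ blockSpanningCount ![(n : ℤ), M, M] 0 ω} := by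
  obtain ⟨cE, hcE, hE⟩ := easyCrossingLowerBound_two
  refine ⟨cE, hcE, fun n hn m M hM => ?_⟩
  have h1' : (bondPercolation (zdGraph 3) (criticalProbI 3)).real
      (boxCrossing 3 (max 1 ((n - 1) / 2)) (2 * max 1 ((n - 1) / 2))) ≤ 1 := measureReal_le_one
  have h1 : 0 ≤ 1 - (bondPercolation (zdGraph 3) (criticalProbI 3)).real
      (boxCrossing 3 (max 1 ((n - 1) / 2)) (2 * max 1 ((n - 1) / 2))) := by linarith
  refine (pow_le_pow_left₀ (by positivity) (mul_le_mul_of_nonneg_right (hE n hn) (pow_nonneg h1 _)) m).trans ?_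
  exact pow_le_real_le_blockSpanningCount (criticalProbI 3) hn m hM

/-- **`X_B` ⇒ ANY NUMBER OF INCIPIENT SPANNING CLUSTERS in thin slab-boxes of `ℤ³`.**  If the aspect-2 annulus is blocked
with probability bounded below at `p_c(ℤ³)` (`PercAnnulusCrossing.CritAnnulusNonCrossing`, stmt-CriticalPhenomena-0846), then
there is `c > 0` with

  `c^m ≤ P_{p_c}(m ≤ blockSpanningCount ![n, M, M] 0)`   for all `n ≥ 1`, `m`, and `M ≥ 30 n m`:

the slab-box `{0..n} × {0..M}²` is traversed in the thin direction by at least `m` distinct open clusters (free b.c.) with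
probability at least `c^m`, uniformly in the thickness `n`.  This is the `d = 3` analogue, CONDITIONAL on `X_B`, of Aizenman's
planar `K_L(m) ≥ h₂(2m-1)^{2m-1} > 0` (Aizenman 1997 §3, (3.0)); unconditionally the tree has `m = 2` for `M ≥ K n`
(`Rsw3.aizenman_twoSpanningClusters_criticalProbI`, Aizenman 1997 Thm. 2) and the dichotomy
`exists_pow_le_real_le_blockSpanningCount_criticalProbI`.  builds on p205010 (kernel theorem, internal audit signed; external
expert review pending). [cite: Aizenman1997, §3 eq. (3.0) and §2 Remark 2] -/
theorem exists_pow_le_real_le_blockSpanningCount_of_critAnnulusNonCrossing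
    (hX : Summit.CriticalPhenomena.PercolationContinuityZ3.Theses.PercAnnulusCrossing.CritAnnulusNonCrossing) :
    ∃ c : ℝ, 0 < c ∧ ∀ n : ℕ, 1 ≤ n → ∀ m M : ℕ, 30 * n * m ≤ M →
      c ^ m ≤ (bondPercolation (zdGraph 3) (criticalProbI 3)).real
        {ω | (m : ℕ∞) ≤ blockSpanningCount ![(n : ℤ), M, M] 0 ω} := by
  obtain ⟨cX, hcX, hX'⟩ := critAnnulusNonCrossing_iff.1 hX
  obtain ⟨c, hc, h⟩ := exists_pow_le_real_le_blockSpanningCount_criticalProbI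
  refine ⟨c * cX ^ 192, by positivity, fun n hn m M hM => ?_⟩
  set r : ℕ := max 1 ((n - 1) / 2) with hr
  have hr1 : 1 ≤ r := le_max_left _ _
  have hu : (bondPercolation (zdGraph 3) (criticalProbI 3)).real (boxCrossing 3 r (2 * r)) ≤ 1 - cX :=
    (measureReal_mono (boxCrossing_subset_annulusCrossing (d := 3) r) (measure_ne_top _ _)).trans (hX' r hr1)
  have hX0 : cX ≤ 1 - (bondPercolation (zdGraph 3) (criticalProbI 3)).real (boxCrossing 3 r (2 * r)) := by linarith
  calc (c * cX ^ 192) ^ m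
      ≤ (c * (1 - (bondPercolation (zdGraph 3) (criticalProbI 3)).real (boxCrossing 3 r (2 * r))) ^ 192) ^ m :=
        pow_le_pow_left₀ (by positivity) (mul_le_mul_of_nonneg_left (pow_le_pow_left₀ hcX.le hX0 192) hc.le) m
    _ ≤ _ := h n hn m M hM

end Rsw3

end Summit.CriticalPhenomena.PercolationContinuityZ3.Theorems

end
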